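import Summits.AtomisticToContinuum.Crystallization.Theses.ExcessDecayLiouville
import Literature.Barriers.AtomisticToContinuum.LocalizedPotentialsExcludeLennardJones

/-!
# Sketch — crux-ideate stmt-AtomisticToContinuum-9333 (`ExcessDecayLiouville.PhononStability`), ideator 1, round 1

First lemmas of the three idea cards (statements only; they elaborate, proofs are not claimed here):

* card `cellwise-polyconvex-certificate`: `TetKorn` — the one-tetrahedron null-Lagrangian (Korn) lemma on the
  honeycomb's own up-tetrahedron `0, u, v, w + √(2/3) e₃`, with the crux's normalisation (`2κ` per unordered edge);
  `TetKornCube` — the same lemma on the congruent cube-inscribed tetrahedron (rational coordinates), PROVED below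
  (`tetKornCube_holds`: an explicit 7-square SOS, `linear_combination`).
* card `contragredient-window-collapse`: `PullbackHess` (strain leaves longitudinal numerators untouched) and
  `HessClosedForm` / `DilationSplit` ((12,6) bi-homogeneity: `s⁸ · Hess(s e, w)` is affine in `σ = s⁻⁶`) — all three
  PROVED below (`pullbackHess_holds`, `hessClosedForm_holds`, `dilationSplit_holds`; helpers `deriv_lennardJones`,
  `deriv_deriv_lennardJones`).
* card `rigid-cluster-far-field`: `OctahedronDiagonal` and `BipyramidAxis` — the longitudinal functional of a far pair
  is a fixed RATIONAL combination of nearest-neighbour longitudinal functionals on the isostatic octahedron / trigonal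
  bipyramid of the hcp honeycomb (valid for ALL vertex displacements, not only affine ones) — both PROVED below
  (`octahedronDiagonal_holds`, `bipyramidAxis_holds`); `OctahedronAbsorption` (Gram eigenvalue 4) PROVED as well
  (`octahedronAbsorption_holds`, a 13-square SOS generated over ℚ).

`lean check`: rc 0, 0 sorries, 0 errors (2026-08-16). Every statement in this file except `TetKorn` (hcp-frame duplicate of the
proved `TetKornCube`) carries a sorry-free proof.
-/

namespace Summit.AtomisticToContinuum.Crystallization.Cruxes.PhononStability.IdeatorOne

open scoped BigOperators Matrix
open Literature.MathematicalPhysics.StatisticalMechanics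

local notation "E3" => EuclideanSpace ℝ (Fin 3)

/-- The crux's pair Hessian `w ↦ wᵀ K(e) w`, verbatim from `ExcessDecayLiouville.PhononStability`. -/
noncomputable def hess (e w : E3) : ℝ :=
  deriv (deriv lennardJones) ‖e‖ * (inner ℝ e w / ‖e‖) ^ 2 +
    deriv lennardJones ‖e‖ / ‖e‖ * (‖w‖ ^ 2 - (inner ℝ e w / ‖e‖) ^ 2)

/-- `r⁻¹²` part of the closed form: `14‖e‖⁻¹⁶ (e·w)² − ‖e‖⁻¹⁴ ‖w‖²`. -/
noncomputable def hess12 (e w : E3) : ℝ :=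
  14 * (‖e‖ ^ 16)⁻¹ * (inner ℝ e w) ^ 2 - (‖e‖ ^ 14)⁻¹ * ‖w‖ ^ 2

/-- `r⁻⁶` part of the closed form: `8‖e‖⁻¹⁰ (e·w)² − ‖e‖⁻⁸ ‖w‖²`. -/
noncomputable def hess6 (e w : E3) : ℝ :=
  8 * (‖e‖ ^ 10)⁻¹ * (inner ℝ e w) ^ 2 - (‖e‖ ^ 8)⁻¹ * ‖w‖ ^ 2

/-- CARD B, first lemma (a): closed form of the Lennard-Jones pair Hessian,
`Hess(e,w) = hess12 e w − hess6 e w` for `e ≠ 0` (from `V' = −r⁻¹³ + r⁻⁷`, `V'' = 13 r⁻¹⁴ − 7 r⁻⁸`). -/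
def HessClosedForm : Prop :=
  ∀ e w : E3, e ≠ 0 → hess e w = hess12 e w - hess6 e w

/-- CARD B, first lemma (b): (12,6) bi-homogeneity — along a dilation ray the Hessian is a two-term sum of
homogeneous pieces, so `s⁸ · Hess(s e, w) = s⁻⁶ · hess12 e w − hess6 e w` is AFFINE in `σ = s⁻⁶`; positivity of an
affine family on an interval is decided at its two endpoints. -/
def DilationSplit : Prop :=
  ∀ (s : ℝ) (e w : E3), 0 < s → e ≠ 0 →
    s ^ 8 * hess (s • e) w = (s ^ 6)⁻¹ * hess12 e w - hess6 e w

/-- CARD B, first lemma (c): contragredient pull-back. For an invertible cell map `A` and the pulled-back displacement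
difference `v = A⁻ᵀ w`, the longitudinal numerator is metric-free: `ê · v = (z · w)/‖A z‖`. Hence
`Hess(Az, A⁻ᵀw) = (V''(r) − V'(r)/r) (z·w)²/r² + (V'(r)/r) ‖A⁻ᵀ w‖²`, `r = ‖A z‖`: the strain `A` enters only through
the scalar `r` and through the Gram band `‖A⁻ᵀw‖² ∈ [0.995⁻², 0.945⁻²]·‖w‖²`. -/
def PullbackHess : Prop :=
  ∀ (A : E3 ≃L[ℝ] E3) (z w : E3), A z ≠ 0 →
    let v : E3 := (ContinuousLinearMap.adjoint (A.symm : E3 →L[ℝ] E3)) w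
    hess (A z) v =
      (deriv (deriv lennardJones) ‖A z‖ - deriv lennardJones ‖A z‖ / ‖A z‖) * (inner ℝ z w) ^ 2 / ‖A z‖ ^ 2 +
        deriv lennardJones ‖A z‖ / ‖A z‖ * ‖v‖ ^ 2

/-- CARD A, first lemma: the one-tetrahedron Korn / null-Lagrangian lemma on the hcp up-tetrahedron
`P = (0, u, v, w + √(2/3)e₃)` (unit edges). For edge weights `φ ≥ 0` (longitudinal), `ψ ≤ 0` (transverse) and
`0 ≤ κ` with `16κ + 8|ψ| ≤ φ`, and ALL vertex displacements `w : Fin 4 → ℝ³`,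
`2κ Σ_e ‖Δ_e w‖² ≤ Σ_e [φ (z_e·Δ_e w)² + ψ ‖Δ_e w‖²] + (8κ − 4ψ) · ½((tr G)² − tr G²)`,
where `G = [w₁−w₀ | w₂−w₀ | w₃−w₀] · X⁻¹` (written out entrywise) is the gradient of the affine interpolant (`X = [u | v | w+√(2/3)e₃]`,
`X⁻¹` written out) and `½((tr G)² − tr G²)` is the isotropic null Lagrangian (sum of principal 2×2 minors), whose
cell-volume-weighted sum over any conforming tiling vanishes for finitely supported displacements. The constant is
sharp on infinitesimal rotations. With the crux's relaxed-cell numbers `φ = 10.7`, `ψ = −0.242` it allows `κ ≤ 0.55`. -/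
def TetKorn : Prop :=
  ∀ φ ψ κ : ℝ, 0 ≤ φ → ψ ≤ 0 → 0 ≤ κ → 16 * κ + 8 * |ψ| ≤ φ →
  ∀ w : Fin 4 → E3,
    let P : Fin 4 → E3 :=
      ![0, !₂[1, 0, 0], !₂[1 / 2, Real.sqrt 3 / 2, 0], !₂[1 / 2, Real.sqrt 3 / 6, Real.sqrt (2 / 3)]]
    let edges : List (Fin 4 × Fin 4) := [(0, 1), (0, 2), (0, 3), (1, 2), (1, 3), (2, 3)]
    let Xinv : Matrix (Fin 3) (Fin 3) ℝ :=
      !![1, -1 / Real.sqrt 3, -1 / Real.sqrt 6; 0, 2 / Real.sqrt 3, -1 / Real.sqrt 6; 0, 0, 3 / Real.sqrt 6]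
    let G : Matrix (Fin 3) (Fin 3) ℝ := fun i j =>
      (w 1 i - w 0 i) * Xinv 0 j + (w 2 i - w 0 i) * Xinv 1 j + (w 3 i - w 0 i) * Xinv 2 j
    let nullLag : ℝ := ((Matrix.trace G) ^ 2 - Matrix.trace (G * G)) / 2
    2 * κ * (edges.map fun e => ‖w e.1 - w e.2‖ ^ 2).sum ≤
      (edges.map fun e => φ * (inner ℝ (P e.1 - P e.2) (w e.1 - w e.2)) ^ 2 + ψ * ‖w e.1 - w e.2‖ ^ 2).sum +
        (8 * κ - 4 * ψ) * nullLag

/-- CARD C, first lemma (a): OCTAHEDRON DIAGONAL IDENTITY. On the regular octahedron with vertices `±e₁, ±e₂, ±e₃`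
(every second-neighbour `√2 a` pair of hcp/fcc is the body diagonal of exactly one octahedron of the honeycomb), the
longitudinal functional of the diagonal is a rational combination of the twelve edge functionals, for EVERY
displacement of the six vertices: with `L a b := (P a − P b) · (w a − w b)`,
`L(top, bot) = ½ Σ_{i ∈ equator} (L(top, i) + L(bot, i)) − ½ Σ_{equatorial edges} L(i, j)`.
(Isostatic rigidity: 12 edges = 18 − 6, so every extra bar's row lies in the row space of the rigidity matrix.) -/
def OctahedronDiagonal : Prop :=
  ∀ w : Fin 6 → E3,
    let P : Fin 6 → E3 := ![!₂[0, 0, 1], !₂[0, 0, -1], !₂[1, 0, 0], !₂[0, 1, 0], !₂[-1, 0, 0], !₂[0, -1, 0]]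
    let L : Fin 6 → Fin 6 → ℝ := fun a b => inner ℝ (P a - P b) (w a - w b)
    L 0 1 = (1 / 2) * ((L 0 2 + L 0 3 + L 0 4 + L 0 5) + (L 1 2 + L 1 3 + L 1 4 + L 1 5)) -
      (1 / 2) * (L 2 3 + L 3 4 + L 4 5 + L 5 2)

/-- CARD C, first lemma (b): TRIGONAL BIPYRAMID AXIS IDENTITY. On the bipyramid with unit equatorial triangle
`0, u, v` and apices `c± = (1/2, √3/6, ±√(2/3))` (two face-sharing tetrahedra of the hcp honeycomb; its axis is the
third-neighbour `√(8/3) a` pair), for EVERY displacement of the five vertices: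
`L(c+, c−) = (2/3) Σ_{polar edges} L(apex, i) − (4/9) Σ_{equatorial edges} L(i, j)`. -/
def BipyramidAxis : Prop :=
  ∀ w : Fin 5 → E3,
    let P : Fin 5 → E3 := ![0, !₂[1, 0, 0], !₂[1 / 2, Real.sqrt 3 / 2, 0],
      !₂[1 / 2, Real.sqrt 3 / 6, Real.sqrt (2 / 3)], !₂[1 / 2, Real.sqrt 3 / 6, -Real.sqrt (2 / 3)]]
    let L : Fin 5 → Fin 5 → ℝ := fun a b => inner ℝ (P a - P b) (w a - w b)
    L 3 4 = (2 / 3) * ((L 3 0 + L 3 1 + L 3 2) + (L 4 0 + L 4 1 + L 4 2)) -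
      (4 / 9) * (L 0 1 + L 1 2 + L 2 0)

/-- CARD C, consequence used by the line (stated for the octahedron): the NEGATIVE longitudinal stiffness `−Φ`
(`Φ ≥ 0`) of the three diagonals is dominated by the edge longitudinal terms with the Gram eigenvalue `4` of the three
coefficient vectors (entries `±½`, pairwise inner products `−1`): `Φ Σ_d (ẑ_d·Δ_d)² ≤ 2Φ Σ_{12 edges} (ẑ_e·Δ_e)²`
(`|z_d|² = 4`, `|z_e|² = 2` here, so in `L`-variables: `Σ_d L_d² / 4 ≤ 2 Σ_e L_e² / 2`). -/
def OctahedronAbsorption : Prop :=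
  ∀ w : Fin 6 → E3,
    let P : Fin 6 → E3 := ![!₂[0, 0, 1], !₂[0, 0, -1], !₂[1, 0, 0], !₂[0, 1, 0], !₂[-1, 0, 0], !₂[0, -1, 0]]
    let L : Fin 6 → Fin 6 → ℝ := fun a b => inner ℝ (P a - P b) (w a - w b)
    (L 0 1 ^ 2 + L 2 4 ^ 2 + L 3 5 ^ 2) / 4 ≤
      (L 0 2 ^ 2 + L 0 3 ^ 2 + L 0 4 ^ 2 + L 0 5 ^ 2 + L 1 2 ^ 2 + L 1 3 ^ 2 + L 1 4 ^ 2 + L 1 5 ^ 2 +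
        L 2 3 ^ 2 + L 3 4 ^ 2 + L 4 5 ^ 2 + L 5 2 ^ 2)

end Summit.AtomisticToContinuum.Crystallization.Cruxes.PhononStability.IdeatorOne

namespace Summit.AtomisticToContinuum.Crystallization.Cruxes.PhononStability.IdeatorOne

/-! ## Proof attempts for the two rigidity identities (pure coordinate algebra) -/

theorem octahedronDiagonal_holds : OctahedronDiagonal := by
  intro w
  simp only [PiLp.inner_apply, RCLike.inner_apply, conj_trivial, Fin.sum_univ_three, PiLp.sub_apply,
    Matrix.cons_val_zero, Matrix.cons_val_one, Matrix.cons_val]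
  norm_num [Matrix.cons_val', Matrix.vecHead, Matrix.vecTail]
  ring

theorem bipyramidAxis_holds : BipyramidAxis := by
  intro w
  simp only [PiLp.inner_apply, RCLike.inner_apply, conj_trivial, Fin.sum_univ_three, PiLp.sub_apply,
    Matrix.cons_val_zero, Matrix.cons_val_one, Matrix.cons_val]
  norm_num [Matrix.cons_val', Matrix.vecHead, Matrix.vecTail]
  ring_nf

end Summit.AtomisticToContinuum.Crystallization.Cruxes.PhononStability.IdeatorOne

namespace Summit.AtomisticToContinuum.Crystallization.Cruxes.PhononStability.IdeatorOne

open Literature.MathematicalPhysics.StatisticalMechanics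

/-! ## Proofs of the card-B identities (calculus of `lennardJones` + adjoint pairing) -/

theorem deriv_lennardJones {r : ℝ} (hr : r ≠ 0) :
    deriv lennardJones r = -(r⁻¹ ^ 13) + r⁻¹ ^ 7 := by
  have hV : lennardJones = fun s : ℝ => (1 / 12) * s ^ (-12 : ℤ) - (1 / 6) * s ^ (-6 : ℤ) := by
    funext s; simp [lennardJones, zpow_neg, zpow_ofNat, inv_pow]
  have hd12 : DifferentiableAt ℝ (fun s : ℝ => s ^ (-12 : ℤ)) r := differentiableAt_zpow.mpr (Or.inl hr)
  have hd6 : DifferentiableAt ℝ (fun s : ℝ => s ^ (-6 : ℤ)) r := differentiableAt_zpow.mpr (Or.inl hr)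
  rw [hV, deriv_fun_sub (hd12.const_mul _) (hd6.const_mul _), deriv_const_mul _ hd12, deriv_const_mul _ hd6,
    deriv_zpow, deriv_zpow]
  rw [show ((-12 : ℤ) - 1) = -13 by norm_num, show ((-6 : ℤ) - 1) = -7 by norm_num, zpow_neg, zpow_neg,
    show (13 : ℤ) = ((13 : ℕ) : ℤ) by norm_num, show (7 : ℤ) = ((7 : ℕ) : ℤ) by norm_num, zpow_natCast,
    zpow_natCast, inv_pow, inv_pow]
  push_cast
  ring

theorem deriv_deriv_lennardJones {r : ℝ} (hr : r ≠ 0) :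
    deriv (deriv lennardJones) r = 13 * r⁻¹ ^ 14 - 7 * r⁻¹ ^ 8 := by
  have h := Literature.Barriers.AtomisticToContinuum.iter_deriv_two_lennardJonesWith (1 / 12) (1 / 6) hr
  rw [← Literature.Barriers.AtomisticToContinuum.lennardJones_eq_lennardJonesWith] at h
  simp only [Function.iterate_succ, Function.iterate_zero, Function.comp_apply, id_eq] at h
  rw [h]; ring

theorem hessClosedForm_holds : HessClosedForm := by
  intro e w he
  have hr : ‖e‖ ≠ 0 := norm_ne_zero_iff.mpr he
  simp only [hess, hess12, hess6, deriv_lennardJones hr, deriv_deriv_lennardJones hr]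
  field_simp
  ring

theorem dilationSplit_holds : DilationSplit := by
  intro s e w hs he
  have hse : s • e ≠ 0 := smul_ne_zero hs.ne' he
  have hr : ‖e‖ ≠ 0 := norm_ne_zero_iff.mpr he
  rw [hessClosedForm_holds (s • e) w hse]
  simp only [hess12, hess6, norm_smul, Real.norm_eq_abs, abs_of_pos hs, real_inner_smul_left]
  field_simp

theorem pullbackHess_holds : PullbackHess := by
  intro A z w hz
  simp only
  have key : inner ℝ (A z) ((ContinuousLinearMap.adjoint (A.symm : EuclideanSpace ℝ (Fin 3) →L[ℝ]
      EuclideanSpace ℝ (Fin 3))) w) = inner ℝ z w := by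
    rw [ContinuousLinearMap.adjoint_inner_right]
    simp
  simp only [hess, key]
  ring

end Summit.AtomisticToContinuum.Crystallization.Cruxes.PhononStability.IdeatorOne

namespace Summit.AtomisticToContinuum.Crystallization.Cruxes.PhononStability.IdeatorOne

/-- CARD A, first lemma in CUBE COORDINATES (rational; proved below): the same one-tetrahedron Korn lemma on the
regular tetrahedron `P = (0, (1,1,0), (1,0,1), (0,1,1))` (edge `√2`; congruent to `√2 ·` the hcp up-tetrahedron of
`TetKorn`). Normalised so that the weights mean the same as in `TetKorn`: the longitudinal term is
`φ (z_e·Δ_e w)²/2 = φ (ẑ_e·Δ_e w)²`, and the null-Lagrangian coefficient doubles (`G` halves its square) to `16κ − 8ψ`. -/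
def TetKornCube : Prop :=
  ∀ φ ψ κ : ℝ, 0 ≤ φ → ψ ≤ 0 → 0 ≤ κ → 16 * κ + 8 * |ψ| ≤ φ →
  ∀ w : Fin 4 → EuclideanSpace ℝ (Fin 3),
    let P : Fin 4 → EuclideanSpace ℝ (Fin 3) := ![0, !₂[1, 1, 0], !₂[1, 0, 1], !₂[0, 1, 1]]
    let edges : List (Fin 4 × Fin 4) := [(0, 1), (0, 2), (0, 3), (1, 2), (1, 3), (2, 3)]
    let Xinv : Matrix (Fin 3) (Fin 3) ℝ := !![1 / 2, 1 / 2, -1 / 2; 1 / 2, -1 / 2, 1 / 2; -1 / 2, 1 / 2, 1 / 2]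
    let G : Matrix (Fin 3) (Fin 3) ℝ := fun i j =>
      (w 1 i - w 0 i) * Xinv 0 j + (w 2 i - w 0 i) * Xinv 1 j + (w 3 i - w 0 i) * Xinv 2 j
    let nullLag : ℝ := ((Matrix.trace G) ^ 2 - Matrix.trace (G * G)) / 2
    2 * κ * (edges.map fun e => ‖w e.1 - w e.2‖ ^ 2).sum ≤
      (edges.map fun e => φ * (inner ℝ (P e.1 - P e.2) (w e.1 - w e.2)) ^ 2 / 2 + ψ * ‖w e.1 - w e.2‖ ^ 2).sum +
        (16 * κ - 8 * ψ) * nullLag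

set_option maxHeartbeats 800000 in
theorem tetKornCube_holds : TetKornCube := by
  intro φ ψ κ hφ hψ hκ hwin w
  rw [abs_of_nonpos hψ] at hwin
  have hc1 : 0 ≤ φ + 8 * ψ - 16 * κ := by linarith
  have hc2 : 0 ≤ φ + 4 * ψ - 8 * κ := by linarith
  have hc3 : 0 ≤ 12 * φ - 12 * ψ + 24 * κ := by linarith
  -- the seven squares of the SOS decomposition (G = [a|b|c]·Xinv, a = w1 - w0, b = w2 - w0, c = w3 - w0)
  have h1 := mul_nonneg hc1 (sq_nonneg ((w 1 0 - w 0 0 + (w 2 0 - w 0 0) - (w 3 0 - w 0 0)) / 2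
    - ((w 1 0 - w 0 0 + (w 2 0 - w 0 0) - (w 3 0 - w 0 0)) / 2 + (w 1 1 - w 0 1 - (w 2 1 - w 0 1) + (w 3 1 - w 0 1)) / 2
      + (-(w 1 2 - w 0 2) + (w 2 2 - w 0 2) + (w 3 2 - w 0 2)) / 2) / 3))
  have h2 := mul_nonneg hc1 (sq_nonneg ((w 1 1 - w 0 1 - (w 2 1 - w 0 1) + (w 3 1 - w 0 1)) / 2
    - ((w 1 0 - w 0 0 + (w 2 0 - w 0 0) - (w 3 0 - w 0 0)) / 2 + (w 1 1 - w 0 1 - (w 2 1 - w 0 1) + (w 3 1 - w 0 1)) / 2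
      + (-(w 1 2 - w 0 2) + (w 2 2 - w 0 2) + (w 3 2 - w 0 2)) / 2) / 3))
  have h3 := mul_nonneg hc1 (sq_nonneg ((-(w 1 2 - w 0 2) + (w 2 2 - w 0 2) + (w 3 2 - w 0 2)) / 2
    - ((w 1 0 - w 0 0 + (w 2 0 - w 0 0) - (w 3 0 - w 0 0)) / 2 + (w 1 1 - w 0 1 - (w 2 1 - w 0 1) + (w 3 1 - w 0 1)) / 2
      + (-(w 1 2 - w 0 2) + (w 2 2 - w 0 2) + (w 3 2 - w 0 2)) / 2) / 3))
  have h4 := mul_nonneg hc2 (sq_nonneg ((w 1 0 - w 0 0 - (w 2 0 - w 0 0) + (w 3 0 - w 0 0)) / 2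
    + (w 1 1 - w 0 1 + (w 2 1 - w 0 1) - (w 3 1 - w 0 1)) / 2))
  have h5 := mul_nonneg hc2 (sq_nonneg ((-(w 1 0 - w 0 0) + (w 2 0 - w 0 0) + (w 3 0 - w 0 0)) / 2
    + (w 1 2 - w 0 2 + (w 2 2 - w 0 2) - (w 3 2 - w 0 2)) / 2))
  have h6 := mul_nonneg hc2 (sq_nonneg ((-(w 1 1 - w 0 1) + (w 2 1 - w 0 1) + (w 3 1 - w 0 1)) / 2
    + (w 1 2 - w 0 2 - (w 2 2 - w 0 2) + (w 3 2 - w 0 2)) / 2))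
  have h7 := mul_nonneg hc3 (sq_nonneg (((w 1 0 - w 0 0 + (w 2 0 - w 0 0) - (w 3 0 - w 0 0)) / 2
    + (w 1 1 - w 0 1 - (w 2 1 - w 0 1) + (w 3 1 - w 0 1)) / 2 + (-(w 1 2 - w 0 2) + (w 2 2 - w 0 2) + (w 3 2 - w 0 2)) / 2) / 3))
  simp only [List.map, List.sum_cons, List.sum_nil, ← real_inner_self_eq_norm_sq, PiLp.inner_apply,
    RCLike.inner_apply, conj_trivial, Fin.sum_univ_three, PiLp.sub_apply, Matrix.trace, Matrix.diag,
    Matrix.mul_apply, Matrix.cons_val_zero, Matrix.cons_val_one, Matrix.cons_val, Matrix.of_apply,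
    Matrix.cons_val', PiLp.zero_apply, Fin.isValue]
  norm_num
  linear_combination h1 + h2 + h3 + h4 + h5 + h6 + h7

end Summit.AtomisticToContinuum.Crystallization.Cruxes.PhononStability.IdeatorOne

namespace Summit.AtomisticToContinuum.Crystallization.Cruxes.PhononStability.IdeatorOne

/-! ## Proof of `OctahedronAbsorption` (Gram eigenvalue 4): explicit SOS
`Σ_e L_e² − ¼Σ_d L_d² = Σ_e (L_e − ¼Σ_d c_{d,e} L_d)² + (1/16)(Σ_d L_d)²`, generated and checked over ℚ
(gen/octa_abs.py in the ideator's folder). -/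

theorem octahedronAbsorption_holds : OctahedronAbsorption := by
  intro w
  simp only [PiLp.inner_apply, RCLike.inner_apply, conj_trivial, Fin.sum_univ_three, PiLp.sub_apply,
    Matrix.cons_val_zero, Matrix.cons_val_one, Matrix.cons_val]
  norm_num [Matrix.cons_val', Matrix.vecHead, Matrix.vecTail]
  linear_combination sq_nonneg (-(w 0 0) + (3/4 : ℝ) * w 0 2 + (1/4 : ℝ) * w 1 2 + (3/4 : ℝ) * w 2 0 - (w 2 2) + (1/4 : ℝ) * w 3 1 + (1/4 : ℝ) * w 4 0 + (-1/4 : ℝ) * w 5 1) + sq_nonneg (-(w 0 1) + (3/4 : ℝ) * w 0 2 + (1/4 : ℝ) * w 1 2 + (1/4 : ℝ) * w 2 0 + (3/4 : ℝ) * w 3 1 - (w 3 2) + (-1/4 : ℝ) * w 4 0 + (1/4 : ℝ) * w 5 1) + sq_nonneg (w 0 0 + (3/4 : ℝ) * w 0 2 + (1/4 : ℝ) * w 1 2 + (-1/4 : ℝ) * w 2 0 + (1/4 : ℝ) * w 3 1 + (-3/4 : ℝ) * w 4 0 - (w 4 2) + (-1/4 : ℝ) * w 5 1) + sq_nonneg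 (w 0 1 + (3/4 : ℝ) * w 0 2 + (1/4 : ℝ) * w 1 2 + (1/4 : ℝ) * w 2 0 + (-1/4 : ℝ) * w 3 1 + (-1/4 : ℝ) * w 4 0 + (-3/4 : ℝ) * w 5 1 - (w 5 2)) + sq_nonneg ((-1/4 : ℝ) * w 0 2 - (w 1 0) + (-3/4 : ℝ) * w 1 2 + (3/4 : ℝ) * w 2 0 + w 2 2 + (1/4 : ℝ) * w 3 1 + (1/4 : ℝ) * w 4 0 + (-1/4 : ℝ) * w 5 1) + sq_nonneg ((-1/4 : ℝ) * w 0 2 - (w 1 1) + (-3/4 : ℝ) * w 1 2 + (1/4 : ℝ) * w 2 0 + (3/4 : ℝ) * w 3 1 + w 3 2 + (-1/4 : ℝ) * w 4 0 + (1/4 : ℝ) * w 5 1) + sq_nonneg ((-1/4 : ℝ) * w 0 2 + w 1 0 + (-3/4 : ℝ) * w 1 2 + (-1/4 : ℝ) * w 2 0 + (1/4 : ℝ) * w 3 1 + (-3/4 : ℝ) * w 4 0 + w 4 2 + (-1/4 : ℝ) * w 5 1) + sq_nonneg ((-1/4 : ℝ) * w 0 2 + w 1 1 + (-3/4 : ℝ)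 * w 1 2 + (1/4 : ℝ) * w 2 0 + (-1/4 : ℝ) * w 3 1 + (-1/4 : ℝ) * w 4 0 + (-3/4 : ℝ) * w 5 1 + w 5 2) + sq_nonneg ((1/4 : ℝ) * w 0 2 + (-1/4 : ℝ) * w 1 2 + (3/4 : ℝ) * w 2 0 - (w 2 1) - (w 3 0) + (3/4 : ℝ) * w 3 1 + (1/4 : ℝ) * w 4 0 + (1/4 : ℝ) * w 5 1) + sq_nonneg ((1/4 : ℝ) * w 0 2 + (-1/4 : ℝ) * w 1 2 + (-1/4 : ℝ) * w 2 0 + w 3 0 + (3/4 : ℝ) * w 3 1 + (-3/4 : ℝ) * w 4 0 - (w 4 1) + (1/4 : ℝ) * w 5 1) + sq_nonneg ((1/4 : ℝ) * w 0 2 + (-1/4 : ℝ) * w 1 2 + (-1/4 : ℝ) * w 2 0 + (-1/4 : ℝ) * w 3 1 + (-3/4 : ℝ) * w 4 0 + w 4 1 + w 5 0 + (-3/4 : ℝ) * w 5 1) + sq_nonneg ((1/4 : ℝ) * w 0 2 + (-1/4 : ℝ) * w 1 2 + (3/4 : ℝ) * w 2 0 + w 2 1 + (-1/4 : ℝ)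 * w 3 1 + (1/4 : ℝ) * w 4 0 - (w 5 0) + (-3/4 : ℝ) * w 5 1) + (1/16 : ℝ) * sq_nonneg ((2 : ℝ) * w 0 2 + (-2 : ℝ) * w 1 2 + (2 : ℝ) * w 2 0 + (2 : ℝ) * w 3 1 + (-2 : ℝ) * w 4 0 + (-2 : ℝ) * w 5 1)

end Summit.AtomisticToContinuum.Crystallization.Cruxes.PhononStability.IdeatorOne

/-! ## Card A, second statement (the identity stub): the discrete null Lagrangian telescopes on the
bipyramid–octahedron tiling of the (t, A)-two-lattice

Orientation-free formulation (`|det X|/6 · M(Wd · X⁻¹)`), i.e. exactly the quantity whose total was checked to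
vanish numerically in job j008342 (selftest: all nine minors, total ≈ 1e-13). Stated under `Adm ∧ Inner` so that no
cell is degenerate (then `X⁻¹` is the true inverse). -/

namespace Summit.AtomisticToContinuum.Crystallization.Cruxes.PhononStability.IdeatorOne

open Literature.MathematicalPhysics.StatisticalMechanics

/-- The 2×2 minor `G_ik G_jl − G_il G_jk` of a 3×3 matrix — a quadratic null Lagrangian of `∇ŵ`. -/
def minor2 (i j k l : Fin 3) (G : Matrix (Fin 3) (Fin 3) ℝ) : ℝ := G i k * G j l - G i l * G j k

/-- Volume-weighted minor of the affine interpolant on a tetrahedron with vertex positions `p` and vertex values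
`w`: `|det X|/6 · minor2 (Wd · X⁻¹)`, `X = [p₁−p₀ | p₂−p₀ | p₃−p₀]`, `Wd = [w₁−w₀ | w₂−w₀ | w₃−w₀]` (columns). -/
noncomputable def tetNull (i j k l : Fin 3) (p w : Fin 4 → EuclideanSpace ℝ (Fin 3)) : ℝ :=
  let X : Matrix (Fin 3) (Fin 3) ℝ := fun m c => (p c.succ - p 0) m
  let Wd : Matrix (Fin 3) (Fin 3) ℝ := fun m c => (w c.succ - w 0) m
  |X.det| / 6 * minor2 i j k l (Wd * X⁻¹)

/-- Trigonal bipyramid = two tetrahedra on the equatorial triangle `(0,1,2)` with apices `3` and `4`. -/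
noncomputable def bpNull (i j k l : Fin 3) (p w : Fin 5 → EuclideanSpace ℝ (Fin 3)) : ℝ :=
  tetNull i j k l ![p 0, p 1, p 2, p 3] ![w 0, w 1, w 2, w 3] +
    tetNull i j k l ![p 0, p 1, p 2, p 4] ![w 0, w 1, w 2, w 4]

/-- Octahedron coned to its centroid (mean position, mean value): eight tetrahedra on the faces
`(0,1,2), (3,4,5), (0,1,3), (0,2,4), (1,2,5), (0,3,4), (1,3,5), (2,4,5)` of the vertex order
`[A u, A v, A (u+v), B w, B (w+u), B (w+v)]` used for `OCT_AB` / `OCT_BA`. -/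
noncomputable def octNull (i j k l : Fin 3) (p w : Fin 6 → EuclideanSpace ℝ (Fin 3)) : ℝ :=
  let pc : EuclideanSpace ℝ (Fin 3) := (1 / 6 : ℝ) • ∑ a : Fin 6, p a
  let wc : EuclideanSpace ℝ (Fin 3) := (1 / 6 : ℝ) • ∑ a : Fin 6, w a
  let faces : List (Fin 6 × Fin 6 × Fin 6) :=
    [(0, 1, 2), (3, 4, 5), (0, 1, 3), (0, 2, 4), (1, 2, 5), (0, 3, 4), (1, 3, 5), (2, 4, 5)]
  (faces.map fun f => tetNull i j k l ![pc, p f.1, p f.2.1, p f.2.2] ![wc, w f.1, w f.2.1, w f.2.2]).sum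

/-- Site `(m; n)` of the (t, A)-two-lattice: `t m + A (n₁ u + n₂ v + n₃ c)`, `c = layerNormal (2√(2/3))`. -/
noncomputable def hcpSite (t : Fin 2 → EuclideanSpace ℝ (Fin 3))
    (A : EuclideanSpace ℝ (Fin 3) →L[ℝ] EuclideanSpace ℝ (Fin 3)) (m : Fin 2) (n : ℤ × ℤ × ℤ) :
    EuclideanSpace ℝ (Fin 3) :=
  t m + A ((n.1 : ℝ) • triangularVec₁ 1 + (n.2.1 : ℝ) • triangularVec₂ 1 +
    (n.2.2 : ℝ) • layerNormal (2 * Real.sqrt (2 / 3)))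

/-- The four cell types of the honeycomb, as lists of (sublattice, integer offset), translated by `n`:
`BP_A = {(0;0),(0;u),(0;v),(1;0),(1;−c)}`, `BP_B = {(1;−u),(1;−v),(1;0),(0;0),(0;c)}`,
`OCT_AB = {(0;u),(0;v),(0;u+v),(1;0),(1;u),(1;v)}`, `OCT_BA = {(0;u+c),(0;v+c),(0;u+v+c),(1;0),(1;u),(1;v)}`. -/
noncomputable def cellNull (t : Fin 2 → EuclideanSpace ℝ (Fin 3))
    (A : EuclideanSpace ℝ (Fin 3) →L[ℝ] EuclideanSpace ℝ (Fin 3)) (u : EuclideanSpace ℝ (Fin 3) → EuclideanSpace ℝ (Fin 3))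
    (i j k l : Fin 3) (c : Fin 4 × (ℤ × ℤ × ℤ)) : ℝ :=
  let n := c.2
  let sh : ℤ × ℤ × ℤ → ℤ × ℤ × ℤ := fun o => (n.1 + o.1, n.2.1 + o.2.1, n.2.2 + o.2.2)
  let P : Fin 2 → ℤ × ℤ × ℤ → EuclideanSpace ℝ (Fin 3) := fun m o => hcpSite t A m (sh o)
  let bpA : Fin 5 → EuclideanSpace ℝ (Fin 3) :=
    ![P 0 (0, 0, 0), P 0 (1, 0, 0), P 0 (0, 1, 0), P 1 (0, 0, 0), P 1 (0, 0, -1)]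
  let bpB : Fin 5 → EuclideanSpace ℝ (Fin 3) :=
    ![P 1 (-1, 0, 0), P 1 (0, -1, 0), P 1 (0, 0, 0), P 0 (0, 0, 0), P 0 (0, 0, 1)]
  let octAB : Fin 6 → EuclideanSpace ℝ (Fin 3) :=
    ![P 0 (1, 0, 0), P 0 (0, 1, 0), P 0 (1, 1, 0), P 1 (0, 0, 0), P 1 (1, 0, 0), P 1 (0, 1, 0)]
  let octBA : Fin 6 → EuclideanSpace ℝ (Fin 3) :=
    ![P 0 (1, 0, 1), P 0 (0, 1, 1), P 0 (1, 1, 1), P 1 (0, 0, 0), P 1 (1, 0, 0), P 1 (0, 1, 0)]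
  match c.1 with
  | 0 => bpNull i j k l bpA (fun a => u (bpA a))
  | 1 => bpNull i j k l bpB (fun a => u (bpB a))
  | 2 => octNull i j k l octAB (fun a => u (octAB a))
  | 3 => octNull i j k l octBA (fun a => u (octBA a))

/-- CARD A, second statement: **the discrete null Lagrangian telescopes.** For every admissible datum and every
finitely supported displacement, the volume-weighted 2×2 minors of the piecewise-affine interpolant sum to zero
over all cells (each minor separately). Discrete Stokes on the tet–oct complex; numerically 0 to 1e-13 (j008342). -/
def NullLagrangianTelescopes : Prop :=
  ∀ (t : Fin 2 → EuclideanSpace ℝ (Fin 3)) (A : EuclideanSpace ℝ (Fin 3) →L[ℝ] EuclideanSpace ℝ (Fin 3)),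
    (∃ R : EuclideanSpace ℝ (Fin 3) ≃ₗᵢ[ℝ] EuclideanSpace ℝ (Fin 3),
      ‖A - (97 / 100 : ℝ) • (R.toContinuousLinearEquiv :
        EuclideanSpace ℝ (Fin 3) →L[ℝ] EuclideanSpace ℝ (Fin 3))‖ ≤ 1 / 40) →
    ‖t 1 - t 0 - A (barlowOffset 1 + layerNormal (Real.sqrt (2 / 3)))‖ ≤ 1 / 40 →
    ∀ u : EuclideanSpace ℝ (Fin 3) → EuclideanSpace ℝ (Fin 3), (Function.support u).Finite →
    ∀ i j k l : Fin 3, HasSum (fun c : Fin 4 × (ℤ × ℤ × ℤ) => cellNull t A u i j k l c) 0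

end Summit.AtomisticToContinuum.Crystallization.Cruxes.PhononStability.IdeatorOne
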